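import Literature.NumberTheory.EllipticCurves.PAdicPowerSeriesCharacterEvaluationProofs
import Literature.NumberTheory.EllipticCurves.PAdicBSDMemIwasawaRatProofs
import HarnessLib

/-!
# Two elements of `Λ ⊗ ℚ_p` with the same values at the characters of `Γ` are equal;
# factorisation of a bounded interpolant through a product of two others (proofs only)

Topic `Literature/NumberTheory/EllipticCurves`, namespace `Literature.NumberTheory.EllipticCurves`.
THEOREMS ONLY (no definition, no named fact; D-0014, D-0026).

`PAdicPowerSeriesZeros` proves the uniqueness principle behind Mazur–Tate–Teitelbaum's
characterisation of `p`-adic `L`-functions (Invent. Math. 84 (1986), §I.12–I.14): an element `D` of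
`Λ ⊗ ℚ_p` (`MemIwasawaRat p D`) vanishing at `χ(γ) - 1` for all primitive characters `χ` of
`Γ = ℤ_p^×/μ_τ` of all conductors `p^{k+3}` is `0` (`MemIwasawaRat.eq_zero_of_forall_hasSum_zero`).
This file draws the working corollaries used when two `p`-adic `L`-functions constructed by
different means are compared through their interpolation properties ("`p`-adic Artin formalism",
e.g. the factorisation of the cyclotomic restriction of a two-variable Rankin–Selberg `p`-adic
`L`-function over an imaginary quadratic field into two Mazur–Tate–Teitelbaum functions,
Perrin-Riou, Invent. Math. 89 (1987) §1; Disegni, Compos. Math. 153 (2017) Lemma 10.2.2; and, on a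
tamely ramified branch, the comparison of the cell memo PROOF-gz §3.4, `run/shared/lean/pub/bsd-addord/`):

* `MemIwasawaRat.exists_norm_coeff_le` — an element of `Λ ⊗ ℚ_p` has bounded coefficients
  (converse of `memIwasawaRat_of_forall_norm_coeff_le`); `MemIwasawaRat.C_mul`,
  `MemIwasawaRat.neg`, `MemIwasawaRat.add` — `Λ ⊗ ℚ_p` is a `ℚ_p`-submodule of `ℚ_p⟦T⟧` closed under
  products (the product lemma is kept private: the Summits side already has `memIwasawaRat_mul`);
* `MemIwasawaRat.summable_eval`, `MemIwasawaRat.hasSum_eval_mul`, `hasSum_eval_C_mul`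
  — evaluation at a point of the open unit disc of `ℂ_p` converges and is multiplicative
  (`tsum_map_coeff_mul_mul_pow` in `HasSum` form);
* `MemIwasawaRat.eq_of_forall_hasSum` — **two elements of `Λ ⊗ ℚ_p` taking the same value at
  `χ(γ) - 1` for every primitive character `χ` of `Γ` of every conductor `p^{k+3}` are EQUAL**;
* `MemIwasawaRat.eq_C_mul_mul_of_forall_hasSum` — **if `G(χ(γ)-1) = c · B₁(χ(γ)-1) · B₂(χ(γ)-1)`
  at all those characters then `G = c · B₁ · B₂`** in `ℚ_p⟦T⟧`;
* `MemIwasawaRat.coeff_one_eq_of_forall_hasSum` —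
  the LEADING-TERM consequence: if moreover `B₁(0) = 0` then `[T¹]G = c · [T¹]B₁ · B₂(0)` (the shape
  "derivative of the product = derivative of the vanishing factor × value of the other factor" of a
  rank-one `p`-adic Gross–Zagier / BSD argument).

What is NOT here: any specific `p`-adic `L`-function; the statements are about abstract elements of
`Λ ⊗ ℚ_p` and abstract values `v χ ∈ ℂ_p`.

References: B. Mazur, J. Tate, J. Teitelbaum, Invent. Math. 84 (1986) §I.12–I.14
[MazurTateTeitelbaum1986Invent]; S. Lang, *Cyclotomic fields I and II*, Ch. 5 §2 Thm. 2.2 [Lang1990];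
L. C. Washington, *Introduction to cyclotomic fields*, GTM 83, §7.2 [Washington1997];
B. Perrin-Riou, Invent. Math. 89 (1987) §1 [PerrinRiou1987]; D. Disegni, Compos. Math. 153 (2017)
Lemma 10.2.2 [Disegni2017].
-/

noncomputable section

open Filter Topology

namespace Literature.NumberTheory.EllipticCurves

variable {p : ℕ} [Fact p.Prime]

/-! ### `Λ ⊗ ℚ_p` is a subalgebra with bounded coefficients -/

/-- **An element of `Λ ⊗ ℚ_p` has bounded coefficients**: if `p^n L = ι G` with `G ∈ ℤ_p⟦T⟧` then
`‖[T^k]L‖ ≤ p^n` for all `k` (Mazur–Tate–Teitelbaum 1986 §I.12: `Λ ⊗ ℚ` is the ring of power series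
with bounded coefficients; converse of `memIwasawaRat_of_forall_norm_coeff_le`).
[cite: MazurTateTeitelbaum1986Invent, §I.12] -/
theorem MemIwasawaRat.exists_norm_coeff_le {L : PowerSeries ℚ_[p]} (hL : MemIwasawaRat p L) :
    ∃ C : ℝ, ∀ k : ℕ, ‖PowerSeries.coeff k L‖ ≤ C := by
  obtain ⟨n, G, hG⟩ := hL
  have hp : (p : ℚ_[p]) ≠ 0 := Nat.cast_ne_zero.mpr (Fact.out : p.Prime).ne_zero
  have hpn : ((p : ℚ_[p]) ^ n) ≠ 0 := pow_ne_zero _ hp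
  refine ⟨‖((p : ℚ_[p]) ^ n)⁻¹‖, fun k ↦ ?_⟩
  have hk : (p : ℚ_[p]) ^ n * PowerSeries.coeff k L = ((PowerSeries.coeff k G : ℤ_[p]) : ℚ_[p]) := by
    have h := congr_arg (PowerSeries.coeff k) hG
    rw [PowerSeries.coeff_C_mul] at h
    rw [h, iwasawaToPowerSeries, PowerSeries.coeff_map, PadicInt.algebraMap_apply]
  have hL' : PowerSeries.coeff k L = ((p : ℚ_[p]) ^ n)⁻¹ * ((PowerSeries.coeff k G : ℤ_[p]) : ℚ_[p]) := by
    rw [← hk, ← mul_assoc, inv_mul_cancel₀ hpn, one_mul]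
  rw [hL', norm_mul]
  calc ‖((p : ℚ_[p]) ^ n)⁻¹‖ * ‖((PowerSeries.coeff k G : ℤ_[p]) : ℚ_[p])‖
      ≤ ‖((p : ℚ_[p]) ^ n)⁻¹‖ * 1 :=
        mul_le_mul_of_nonneg_left (PadicInt.norm_le_one _) (norm_nonneg _)
    _ = _ := mul_one _

/-- `Λ ⊗ ℚ_p` is closed under multiplication: `p^{n₁} L₁ = G₁`, `p^{n₂} L₂ = G₂` give
`p^{n₁+n₂} (L₁ L₂) = G₁ G₂` (Mazur–Tate–Teitelbaum 1986 §I.12: `Λ ⊗ ℚ` is a ring). Private copy of the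
Summits-side `Summit.BirchSwinnertonDyer.Rank1Residual.Additive.memIwasawaRat_mul` (a Literature file
cannot import it). [folklore] -/
private theorem MemIwasawaRat.mul' {L₁ L₂ : PowerSeries ℚ_[p]} (h₁ : MemIwasawaRat p L₁)
    (h₂ : MemIwasawaRat p L₂) : MemIwasawaRat p (L₁ * L₂) := by
  obtain ⟨n₁, G₁, hG₁⟩ := h₁
  obtain ⟨n₂, G₂, hG₂⟩ := h₂
  refine ⟨n₁ + n₂, G₁ * G₂, ?_⟩
  rw [map_mul, ← hG₁, ← hG₂, pow_add, map_mul]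
  ring

/-- `Λ ⊗ ℚ_p` is closed under negation (Mazur–Tate–Teitelbaum 1986 §I.12: `Λ ⊗ ℚ` is a ring).
[cite: MazurTateTeitelbaum1986Invent, §I.12] -/
theorem MemIwasawaRat.neg {L : PowerSeries ℚ_[p]} (h : MemIwasawaRat p L) : MemIwasawaRat p (-L) := by
  obtain ⟨n, G, hG⟩ := h
  exact ⟨n, -G, by rw [map_neg, ← hG, mul_neg]⟩

/-- `Λ ⊗ ℚ_p` is closed under addition (Mazur–Tate–Teitelbaum 1986 §I.12: `Λ ⊗ ℚ` is a ring).
[cite: MazurTateTeitelbaum1986Invent, §I.12] -/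
theorem MemIwasawaRat.add {L₁ L₂ : PowerSeries ℚ_[p]} (h₁ : MemIwasawaRat p L₁)
    (h₂ : MemIwasawaRat p L₂) : MemIwasawaRat p (L₁ + L₂) := by
  have h := h₁.sub h₂.neg
  rwa [sub_neg_eq_add] at h

/-- `Λ ⊗ ℚ_p` is stable under multiplication by constants `c ∈ ℚ_p` (bounded coefficients stay
bounded; Mazur–Tate–Teitelbaum 1986 §I.12: `Λ ⊗ ℚ` is a `ℚ_p`-algebra).
[cite: MazurTateTeitelbaum1986Invent, §I.12] -/
theorem MemIwasawaRat.C_mul {L : PowerSeries ℚ_[p]} (h : MemIwasawaRat p L) (c : ℚ_[p]) :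
    MemIwasawaRat p (PowerSeries.C c * L) := by
  obtain ⟨C, hC⟩ := h.exists_norm_coeff_le
  refine memIwasawaRat_of_forall_norm_coeff_le (C := ‖c‖ * C) fun k ↦ ?_
  rw [PowerSeries.coeff_C_mul, norm_mul]
  exact mul_le_mul_of_nonneg_left (hC k) (norm_nonneg _)

/-! ### Evaluation on the open unit disc of `ℂ_p` -/

/-- The evaluation series `∑_k [T^k]L · z^k` of an element of `Λ ⊗ ℚ_p` at a point `|z| < 1` of
`ℂ_p` is summable (domination by a geometric series; Washington GTM 83 §7.2: elements of `Λ ⊗ ℚ_p`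
converge on the open unit disc). [cite: Washington1997, §7.2] -/
theorem MemIwasawaRat.summable_eval {L : PowerSeries ℚ_[p]} (hL : MemIwasawaRat p L) {z : ℂ_[p]}
    (hz : ‖z‖ < 1) :
    Summable fun k ↦ algebraMap ℚ_[p] ℂ_[p] (PowerSeries.coeff k L) * z ^ k := by
  obtain ⟨C, hC⟩ := hL.exists_norm_coeff_le
  exact summable_map_coeff_mul_pow (algebraMap ℚ_[p] ℂ_[p])
    (fun k ↦ by rw [norm_algebraMap']; exact hC k) hz

/-- **Evaluation is multiplicative** (`HasSum` form of `tsum_map_coeff_mul_mul_pow`): if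
`L₁(z) = v₁` and `L₂(z) = v₂` for `L₁, L₂ ∈ Λ ⊗ ℚ_p` and `|z| < 1`, then `(L₁ L₂)(z) = v₁ v₂`
(Washington GTM 83 §7.2: evaluation on the open disc is a ring homomorphism on `Λ ⊗ ℚ_p`).
[cite: Washington1997, §7.2] -/
theorem MemIwasawaRat.hasSum_eval_mul {L₁ L₂ : PowerSeries ℚ_[p]} (h₁ : MemIwasawaRat p L₁)
    (h₂ : MemIwasawaRat p L₂) {z : ℂ_[p]} (hz : ‖z‖ < 1) {v₁ v₂ : ℂ_[p]}
    (hv₁ : HasSum (fun k ↦ algebraMap ℚ_[p] ℂ_[p] (PowerSeries.coeff k L₁) * z ^ k) v₁)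
    (hv₂ : HasSum (fun k ↦ algebraMap ℚ_[p] ℂ_[p] (PowerSeries.coeff k L₂) * z ^ k) v₂) :
    HasSum (fun k ↦ algebraMap ℚ_[p] ℂ_[p] (PowerSeries.coeff k (L₁ * L₂)) * z ^ k) (v₁ * v₂) := by
  obtain ⟨C₁, hC₁⟩ := h₁.exists_norm_coeff_le
  obtain ⟨C₂, hC₂⟩ := h₂.exists_norm_coeff_le
  have hb₁ : ∀ k, ‖algebraMap ℚ_[p] ℂ_[p] (PowerSeries.coeff k L₁)‖ ≤ C₁ := fun k ↦ by
    rw [norm_algebraMap']; exact hC₁ k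
  have hb₂ : ∀ k, ‖algebraMap ℚ_[p] ℂ_[p] (PowerSeries.coeff k L₂)‖ ≤ C₂ := fun k ↦ by
    rw [norm_algebraMap']; exact hC₂ k
  have hprod := tsum_map_coeff_mul_mul_pow (algebraMap ℚ_[p] ℂ_[p]) hb₁ hb₂ hz
  rw [hv₁.tsum_eq, hv₂.tsum_eq] at hprod
  rw [← hprod]
  exact ((h₁.mul' h₂).summable_eval hz).hasSum

/-- Evaluation of `C c · L` at `z` is `c · L(z)` (linearity of evaluation; Washington GTM 83 §7.2).
[cite: Washington1997, §7.2] -/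
theorem hasSum_eval_C_mul {L : PowerSeries ℚ_[p]} (c : ℚ_[p]) {z : ℂ_[p]} {v : ℂ_[p]}
    (hv : HasSum (fun k ↦ algebraMap ℚ_[p] ℂ_[p] (PowerSeries.coeff k L) * z ^ k) v) :
    HasSum (fun k ↦ algebraMap ℚ_[p] ℂ_[p] (PowerSeries.coeff k (PowerSeries.C c * L)) * z ^ k)
      (algebraMap ℚ_[p] ℂ_[p] c * v) := by
  have h : (fun k ↦ algebraMap ℚ_[p] ℂ_[p] (PowerSeries.coeff k (PowerSeries.C c * L)) * z ^ k) =
      fun k ↦ algebraMap ℚ_[p] ℂ_[p] c * (algebraMap ℚ_[p] ℂ_[p] (PowerSeries.coeff k L) * z ^ k) := by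
    funext k
    rw [PowerSeries.coeff_C_mul, map_mul, mul_assoc]
  rw [h]
  exact hv.mul_left _

/-! ### Uniqueness from interpolation agreement -/

/-- **Two elements of `Λ ⊗ ℚ_p` with the same values at the characters of `Γ` are equal.** If
`G, H ∈ Λ ⊗ ℚ_p` and for every `k` and every primitive even Dirichlet character `χ` modulo `p^{k+3}`
of `p`-power order with values in `ℂ_p` the two evaluation series at `T = χ(γ) - 1` have a common
sum, then `G = H` (apply `MemIwasawaRat.eq_zero_of_forall_hasSum_zero` to `G - H`;
Mazur–Tate–Teitelbaum 1986 §I.12–I.14: "`L_p` is uniquely determined by the interpolation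
property"). [cite: MazurTateTeitelbaum1986Invent, §I.12–I.14] -/
theorem MemIwasawaRat.eq_of_forall_hasSum {G H : PowerSeries ℚ_[p]} (hG : MemIwasawaRat p G)
    (hH : MemIwasawaRat p H)
    (h : ∀ (k : ℕ) (χ : DirichletCharacter ℂ_[p] (p ^ (k + 3))), χ.IsPrimitive → χ.Even →
      (∃ j : ℕ, orderOf χ = p ^ j) → ∃ v : ℂ_[p],
        HasSum (fun i ↦ algebraMap ℚ_[p] ℂ_[p] (PowerSeries.coeff i G) *
          (χ (cyclotomicGenerator p : ZMod (p ^ (k + 3))) - 1) ^ i) v ∧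
        HasSum (fun i ↦ algebraMap ℚ_[p] ℂ_[p] (PowerSeries.coeff i H) *
          (χ (cyclotomicGenerator p : ZMod (p ^ (k + 3))) - 1) ^ i) v) :
    G = H := by
  have hD : MemIwasawaRat p (G - H) := hG.sub hH
  refine sub_eq_zero.mp (hD.eq_zero_of_forall_hasSum_zero fun k χ hχ heven hord ↦ ?_)
  obtain ⟨v, hvG, hvH⟩ := h k χ hχ heven hord
  have hsub := hvG.sub hvH
  rw [sub_self] at hsub
  have hfun : (fun i ↦ algebraMap ℚ_[p] ℂ_[p] (PowerSeries.coeff i (G - H)) *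
      (χ (cyclotomicGenerator p : ZMod (p ^ (k + 3))) - 1) ^ i) =
      fun i ↦ algebraMap ℚ_[p] ℂ_[p] (PowerSeries.coeff i G) *
        (χ (cyclotomicGenerator p : ZMod (p ^ (k + 3))) - 1) ^ i -
        algebraMap ℚ_[p] ℂ_[p] (PowerSeries.coeff i H) *
        (χ (cyclotomicGenerator p : ZMod (p ^ (k + 3))) - 1) ^ i := by
    funext i
    rw [map_sub, map_sub, sub_mul]
  rw [hfun]
  exact hsub

/-- **Factorisation of a bounded interpolant through a product.** Let `G, B₁, B₂ ∈ Λ ⊗ ℚ_p` and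
`c ∈ ℚ_p`, and suppose that at every primitive even character `χ` of `Γ` of `p`-power order and
conductor `p^{k+3}` the value of `G` is `c` times the product of the values of `B₁` and `B₂`:
whenever `B₁(χ(γ)-1) = v₁` and `B₂(χ(γ)-1) = v₂` then `G(χ(γ)-1) = c · v₁ · v₂`. Then
`G = c · B₁ · B₂` in `ℚ_p⟦T⟧` (evaluation is multiplicative on `Λ ⊗ ℚ_p` and the uniqueness
principle applies to `G - c B₁ B₂`). This is the formal skeleton of a "`p`-adic Artin formalism":
e.g. the cyclotomic restriction of a Rankin–Selberg `p`-adic `L`-function over an imaginary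
quadratic field versus the product of the two Mazur–Tate–Teitelbaum functions of `f` and `f ⊗ η_K`
(Perrin-Riou 1987 §1; Disegni 2017 Lemma 10.2.2). [cite: MazurTateTeitelbaum1986Invent, §I.12–I.14]
[cite: Disegni2017, Lemma 10.2.2 (factorisation of the cyclotomic restriction)] -/
theorem MemIwasawaRat.eq_C_mul_mul_of_forall_hasSum {G B₁ B₂ : PowerSeries ℚ_[p]}
    (hG : MemIwasawaRat p G) (hB₁ : MemIwasawaRat p B₁) (hB₂ : MemIwasawaRat p B₂) (c : ℚ_[p])
    (h : ∀ (k : ℕ) (χ : DirichletCharacter ℂ_[p] (p ^ (k + 3))), χ.IsPrimitive → χ.Even →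
      (∃ j : ℕ, orderOf χ = p ^ j) → ∀ v₁ v₂ : ℂ_[p],
        HasSum (fun i ↦ algebraMap ℚ_[p] ℂ_[p] (PowerSeries.coeff i B₁) *
          (χ (cyclotomicGenerator p : ZMod (p ^ (k + 3))) - 1) ^ i) v₁ →
        HasSum (fun i ↦ algebraMap ℚ_[p] ℂ_[p] (PowerSeries.coeff i B₂) *
          (χ (cyclotomicGenerator p : ZMod (p ^ (k + 3))) - 1) ^ i) v₂ →
        HasSum (fun i ↦ algebraMap ℚ_[p] ℂ_[p] (PowerSeries.coeff i G) *
          (χ (cyclotomicGenerator p : ZMod (p ^ (k + 3))) - 1) ^ i)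
          (algebraMap ℚ_[p] ℂ_[p] c * v₁ * v₂)) :
    G = PowerSeries.C c * B₁ * B₂ := by
  have hP : MemIwasawaRat p (PowerSeries.C c * B₁ * B₂) := (hB₁.C_mul c).mul' hB₂
  refine hG.eq_of_forall_hasSum hP fun k χ hχ heven hord ↦ ?_
  have hz : ‖χ (cyclotomicGenerator p : ZMod (p ^ (k + 3))) - 1‖ < 1 :=
    norm_apply_cyclotomicGenerator_sub_one_lt χ hord
  obtain ⟨v₁, hv₁⟩ := hB₁.summable_eval hz
  obtain ⟨v₂, hv₂⟩ := hB₂.summable_eval hz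
  refine ⟨algebraMap ℚ_[p] ℂ_[p] c * v₁ * v₂, h k χ hχ heven hord v₁ v₂ hv₁ hv₂, ?_⟩
  exact (hB₁.C_mul c).hasSum_eval_mul hB₂ hz (hasSum_eval_C_mul c hv₁) hv₂

/-! ### The leading-term consequence -/

/-- Coefficient bookkeeping in `R⟦T⟧`: if `B₁(0) = 0` then `[T¹](c · B₁ · B₂) = c · [T¹]B₁ · B₂(0)`.
[folklore] -/
private theorem coeff_one_C_mul_mul_of_constantCoeff_eq_zero {R : Type*} [CommRing R] (c : R)
    (B₁ B₂ : PowerSeries R) (h0 : PowerSeries.constantCoeff B₁ = 0) :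
    PowerSeries.coeff 1 (PowerSeries.C c * B₁ * B₂) =
      c * PowerSeries.coeff 1 B₁ * PowerSeries.constantCoeff B₂ := by
  rw [mul_assoc, PowerSeries.coeff_C_mul, PowerSeries.coeff_mul, Finset.Nat.antidiagonal_succ,
    Finset.sum_cons, Finset.Nat.antidiagonal_zero]
  simp [h0, mul_assoc]

/-- **Leading term of a factorised interpolant.** Under the hypotheses of
`MemIwasawaRat.eq_C_mul_mul_of_forall_hasSum`, if the first factor vanishes at `T = 0` then
`G(0) = 0` and `[T¹]G = c · [T¹]B₁ · B₂(0)` — the rank-one shape "derivative of `G` = `c` ×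
derivative of `B₁` × VALUE of `B₂`" (as in Perrin-Riou 1987 §1.4 / PROOF-gz §3.4 (F″)).
[cite: MazurTateTeitelbaum1986Invent, §I.12–I.14] [cite: PerrinRiou1987, §1.4 (shape)] -/
theorem MemIwasawaRat.coeff_one_eq_of_forall_hasSum {G B₁ B₂ : PowerSeries ℚ_[p]}
    (hG : MemIwasawaRat p G) (hB₁ : MemIwasawaRat p B₁) (hB₂ : MemIwasawaRat p B₂) (c : ℚ_[p])
    (h : ∀ (k : ℕ) (χ : DirichletCharacter ℂ_[p] (p ^ (k + 3))), χ.IsPrimitive → χ.Even →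
      (∃ j : ℕ, orderOf χ = p ^ j) → ∀ v₁ v₂ : ℂ_[p],
        HasSum (fun i ↦ algebraMap ℚ_[p] ℂ_[p] (PowerSeries.coeff i B₁) *
          (χ (cyclotomicGenerator p : ZMod (p ^ (k + 3))) - 1) ^ i) v₁ →
        HasSum (fun i ↦ algebraMap ℚ_[p] ℂ_[p] (PowerSeries.coeff i B₂) *
          (χ (cyclotomicGenerator p : ZMod (p ^ (k + 3))) - 1) ^ i) v₂ →
        HasSum (fun i ↦ algebraMap ℚ_[p] ℂ_[p] (PowerSeries.coeff i G) *
          (χ (cyclotomicGenerator p : ZMod (p ^ (k + 3))) - 1) ^ i)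
          (algebraMap ℚ_[p] ℂ_[p] c * v₁ * v₂))
    (h0 : PowerSeries.constantCoeff B₁ = 0) :
    PowerSeries.constantCoeff G = 0 ∧
      PowerSeries.coeff 1 G = c * PowerSeries.coeff 1 B₁ * PowerSeries.constantCoeff B₂ := by
  have hfac := hG.eq_C_mul_mul_of_forall_hasSum hB₁ hB₂ c h
  refine ⟨?_, ?_⟩
  · rw [hfac, map_mul, map_mul, h0, mul_zero, zero_mul]
  · rw [hfac, coeff_one_C_mul_mul_of_constantCoeff_eq_zero c B₁ B₂ h0]

end Literature.NumberTheory.EllipticCurves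

end
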